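import Summits.CriticalPhenomena.CardyFormulaZ2.Theorems.CardyIKTransportIKLinearTransportWallDominationPlanarFinal
import Summits.CriticalPhenomena.CardyFormulaZ2.Theorems.CardyIKTransportIKLinearTransportWallDominationPlanarSmall

/-!
# `CardyIKTransport.IKLinearTransport` (stmt-CriticalPhenomena-5076), line `pinned-diagram-exchange`, lead c8 —
# THIN RINGS AROUND WALL SEGMENTS IN THE PLANE, ISOTROPIC MODEL: ALL SEGMENT LENGTHS `s ≥ 1`

Support file (`--supports stmt-CriticalPhenomena-5076`, registered sub-goal `thinRing_planar_iso_all`): the two-line combination of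
`thinRing_planar_iso` (lead, `s ≥ N`: wall domination + band transfer + blockers + lattice Jordan) and `thinRing_planar_small` (worker B15,
`1 ≤ s ≤ N`: finite energy of the gauge on the all-black band box).
-/

noncomputable section

namespace Summit.CriticalPhenomena.CardyFormulaZ2.Theorems.IKLinearTransport.PinnedDiagramExchange.WallDomination

open Summit.CriticalPhenomena.CardyFormulaZ2.Theorems.IKLinearTransport.PinnedDiagramExchange (νmix)

/-- **THIN RINGS AROUND WALL SEGMENTS IN THE PLANE, ISOTROPIC IZERGIN–KOREPIN MODEL, EVERY LENGTH** (registered sub-goal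
`thinRing_planar_iso_all`): there are `j` and `c > 0` such that for every `s ≥ 1` and every `(a, b) ∈ ℤ²`, with `ν_univ`-probability `≥ c` every black
path meeting the wall segment `{a} × [b, b + s)` stays within sup-distance `2M + 3s` of it, `M = (2j+1)(s+1)` — `RingSeg a b s (2M + 3s)`. -/
theorem thinRing_planar_iso_all : ∃ (j : ℕ) (c : ℝ), 0 < c ∧ ∀ (s : ℕ) (a b : ℤ), 1 ≤ s →
    c ≤ (νmix Set.univ).real (RingSeg a b s (2 * ((2 * j + 1) * (s + 1)) + 3 * s)) := by
  obtain ⟨N, j, c, hc, h⟩ := thinRing_planar_iso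
  obtain ⟨c', hc', h'⟩ := thinRing_planar_small N j
  refine ⟨j, min c c', lt_min hc hc', fun s a b hs => ?_⟩
  rcases le_or_gt N s with hN | hN
  · exact (min_le_left _ _).trans (h s a b hN)
  · exact (min_le_right _ _).trans (h' s a b hs hN.le)

end Summit.CriticalPhenomena.CardyFormulaZ2.Theorems.IKLinearTransport.PinnedDiagramExchange.WallDomination

end
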